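import Literature.Probability.RandomPlanarGeometry.HexSAWEndpointMonotone
import Literature.Probability.RandomPlanarGeometry.HexSAWPolygonRatioLowerRate
import Literature.Probability.RandomPlanarGeometry.HexSAWBrickWallSlabStrict
import Literature.Probability.RandomPlanarGeometry.SAWEndpointRateLowerInsertion
import HarnessLib

/-!
# Kesten's LOWER ratio rate for EVERY endpoint of the honeycomb lattice:
# `(2+√2) − c_{N+2}(0,x;ℍ)/c_N(0,x;ℍ) ≤ K·N^{-1/3}` — hence (7.5.2) two-sided on `ℍ` in full

Topic `Literature/Probability/RandomPlanarGeometry` (lane «pcv-sawmu», a-p4 g8; assembles `HexSAWPolygonConcatenation.lean`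
— the brick join `HexBW.PolygonConcat.glue_mem` for an arbitrary endpoint and `detour_decode` —, `HexSAWEndpointCarriers.lean` /
`HexSAWEndpointMonotone.lean` — the envelope `HV.hexEndpointLo_of_ne`, the `¼` upper rate `hexEndpointRatioTwo_upperRate` and the
eventual monotonicity `endFin_eventually_mono_iter_of_ne` —, `HexSAWEndpointRatioRate.lean` — the spliced sequence `spliceE` —, the
tree engine `Zd.KestenRateLower.lower_rate_cubeRoot_ins`, and the lane's column-slab theory `HexSAWBrickWallSlabStrict.lean`
(a-p5: `HexBW.slabCount`, `tendsto_slabCount_rpow`, `slabConnectiveConstant_lt_hex` — the honeycomb ARMCHAIR slabs are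
sub-critical)).

Source: N. Madras, G. Slade, *The Self-Avoiding Walk* (1993), §7.5, eq. (7.5.2) p. 255 (Kesten 1963): for fixed `x ≠ 0`,
"`−K N^{−1/3} ≤ c_{N+2}(0,x)/c_N(0,x) − μ² ≤ K N^{−1/4}`" (`ℤ^d`, stated without proof; tree twin with both rates
`Zd.Kesten1963_ratioRate_endpoint_allDim`).  THIS FILE proves the lower half on `ℍ` for EVERY endpoint, no hypotheses.

## Mechanism

The engine needs the insertion inequality `#E_{N'}(x) · e_M ≤ poly · #E_{N'+2M}(x)`.  A rooted polygon can be spliced (brick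
join) into a walk `ω : 0 → x` at a vertical walk bond of an EXTREME column of `ω`; such a bond exists as soon as the extreme
column contains an INTERIOR vertex (degree count), on the right directly and on the left through the reflection `a ↦ −a`
(`Zd.reflCoord 0`, an automorphism fixing `0`).  The remaining «both-bad» walks have both extreme columns attained only at
their endpoints, hence live in the column slab between `0` and `x`: there are at most `c_{N'}(Slab_{|x₀|})` of them, and since
`μ(Slab_H) < μ_ℍ` (a-p5's `slabConnectiveConstant_lt_hex`) while `#E_{N'}(x) ≥ e^{−c√N'} μ_ℍ^{N'}` (G3), they are fewer than
half of `E_{N'}(x)` for large `N'`; so `#E_{N'}(x) · #E_m(e₀) ≤ 8 N' m · #E_{N'+m+3}(x)`, and the engine fires exactly as for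
polygons (`HexSAWPolygonRatioLowerRate.lean`).

## Contents (namespaces `…SAW.HexBW.PolygonConcat` and `…SAW.HV`; all PROVED, NO hypotheses beyond `x ≠ 0`)

* `reflW`, `reflW_apply_zero`, `reflW_reflW`, `reflW_mem` (the reflection `a ↦ −a` on `E_n(x)`);
  `exists_vertical_of_interior`, `exists_vertical_of_interior_min` (interior extreme vertex ⇒ vertical walk bond there);
* `RightBond`, `LeftBond`, `rightBond_reflW_iff`, `ins`, `mem_ins`, `insDatum`, `insDatum_spec`, `sideGlue`, `sideGlue_mem`,
  `outer_eq_of_glue_eq`, `insCode`, `insCode_injOn`, **`card_ins_mul_le`** (`#Ins_n(x) · c_m(0,e₀;ℍ) ≤ 4nm · c_{n+m+3}(0,x;ℍ)`, `m ≥ 2`);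
* `notIns`, `card_endAt_eq_ins_add`, **`confined_of_notIns`** (both-bad ⇒ confined to the slab between `0` and `x`),
  `notIns_eq_empty_of_zero` (`x₀ = 0`, `n ≥ 2`), **`card_notIns_le_slabCount`** (`≤ c_n(Slab_{|x₀|})`, a-p5's `HexBW.slabCount`);
* `HV.slabCount_eventually_le_half` (`2·c_N(Slab_H) ≤ #E_N(x)` eventually along the class, from `μ(Slab_H) < μ_ℍ`);
* **`HV.hexEndpointRatioTwo_lowerRate (hx : x ≠ hvOrigin)`** — the `⅓` lower rate for every endpoint;
* **`HV.hexEndpointRatioTwo_rate (hx : x ≠ hvOrigin)`** — (7.5.2) on `ℍ`, both sides, every endpoint.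

Dependencies (HOME at banking time): `HexSAWPolygonConcatenation` / `HexSAWPolygonRatioLowerRate` / `HexSAWEndpointCarriers` /
`HexSAWEndpointMonotone` (a-p4 g8, train ②) and `HexSAWBrickWallSlab…Strict` (a-p5 g7, door R100); files after both chains land.
-/

noncomputable section

open Finset Function Filter Topology Literature.Probability.LatticeModels Literature.Probability.Percolation SimpleGraph

namespace Literature.Probability.RandomPlanarGeometry.SAW

namespace HexBW

namespace PolygonConcat

/-! ### Reflection in the column of the origin -/

section Refl

variable {n : ℕ} {ω : ℕ → Site 2} {x : Site 2}

/-- The reflection `a ↦ −a` applied to a walk. [cite: MadrasSlade1993, §1.1 (lattice symmetry of `c_n(0,x)`)] -/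
def reflW (ω : ℕ → Site 2) : ℕ → Site 2 := fun k => Zd.reflCoord 0 (ω k)

/-- First coordinate of the reflected walk. [cite: MadrasSlade1993, §1.1 (lattice symmetry)] -/
@[simp] theorem reflW_apply_zero (ω : ℕ → Site 2) (k : ℕ) : reflW ω k 0 = -ω k 0 := by
  simp [reflW]

/-- The reflection is an involution on walks. [cite: MadrasSlade1993, §1.1 (lattice symmetry)] -/
@[simp] theorem reflW_reflW (ω : ℕ → Site 2) : reflW (reflW ω) = ω := by
  funext k; simp [reflW]

/-- The reflection maps `E_n(x)` to `E_n(x̄)`, `x̄ = (−x₀, x₁)`. [cite: MadrasSlade1993, §1.1 (lattice symmetry of `c_n(0,x)`)] -/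
theorem reflW_mem (hω : ω ∈ endAt n x) : reflW ω ∈ endAt n (Zd.reflCoord 0 x) := by
  rw [mem_endAt] at hω ⊢
  exact ⟨reflect_mem_saws hω.1, by simp only [reflW, hω.2]⟩

end Refl

/-! ### An interior vertex in an extreme column carries a vertical walk bond -/

section Interior

variable {n : ℕ} {ω : ℕ → Site 2} {x : Site 2}

/-- If the rightmost column of `ω ∈ E_n(x)` contains an INTERIOR vertex `ω i` (`0 < i < n`), then it contains a vertical walk
bond `{ω j, ω (j+1)}`: the two walk-neighbours of `ω i` are not to its right and cannot both be its left neighbour.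
[cite: MadrasSlade1993, Lemma 7.3.3 (proof: the first point of maximal norm "is not an endpoint of ω")] -/
theorem exists_vertical_of_interior (hω : ω ∈ endAt n x) {i : ℕ} (hi0 : 0 < i) (hin : i < n)
    (hmax : ∀ k, k ≤ n → ω k 0 ≤ ω i 0) :
    ∃ j, j < n ∧ ω (j + 1) 0 = ω j 0 ∧ ∀ k, k ≤ n → ω k 0 ≤ ω j 0 := by
  obtain ⟨⟨-, -, hbw, hinj⟩, -⟩ := mem_endAt_iff.1 hω
  have h1 := hbw (i - 1) (by omega)
  rw [show i - 1 + 1 = i by omega] at h1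
  have h2 := hbw i hin
  have hl := hmax (i - 1) (by omega)
  have hr := hmax (i + 1) (by omega)
  by_cases hv2 : ω (i + 1) 0 = ω i 0
  · exact ⟨i, hin, hv2, hmax⟩
  by_cases hv1 : ω (i - 1) 0 = ω i 0
  · refine ⟨i - 1, by omega, ?_, fun k hk => ?_⟩
    · rw [show i - 1 + 1 = i by omega]; exact hv1.symm
    · rw [hv1]; exact hmax k hk
  exfalso
  rcases adj_cases h1.symm with ⟨a, -⟩ | ⟨a, b⟩ | a
  · omega
  · rcases adj_cases h2 with ⟨c, -⟩ | ⟨c, d⟩ | c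
    · omega
    · have heq : ω (i - 1) = ω (i + 1) := by
        funext l; fin_cases l
        · show ω (i - 1) 0 = ω (i + 1) 0; omega
        · show ω (i - 1) 1 = ω (i + 1) 1; omega
      have := hinj (show i - 1 ∈ {k | k ≤ n} by simp; omega) (show i + 1 ∈ {k | k ≤ n} by simp; omega) heq
      omega
    · exact hv2 c
  · exact hv1 a

/-- The same on the LEFT: an interior vertex in the leftmost column gives a vertical walk bond there.
[cite: MadrasSlade1993, Lemma 7.3.3 (proof)] -/
theorem exists_vertical_of_interior_min (hω : ω ∈ endAt n x) {i : ℕ} (hi0 : 0 < i) (hin : i < n)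
    (hmin : ∀ k, k ≤ n → ω i 0 ≤ ω k 0) :
    ∃ j, j < n ∧ ω (j + 1) 0 = ω j 0 ∧ ∀ k, k ≤ n → ω j 0 ≤ ω k 0 := by
  have hω' := reflW_mem hω
  obtain ⟨j, hj, hv, hX⟩ := exists_vertical_of_interior hω' hi0 hin (fun k hk => by
    simp only [reflW_apply_zero]; have := hmin k hk; omega)
  refine ⟨j, hj, ?_, fun k hk => ?_⟩
  · simp only [reflW_apply_zero] at hv; omega
  · have := hX k hk; simp only [reflW_apply_zero] at this; omega

end Interior

/-! ### Two-sided insertion for insertable walks -/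

section Ins

variable {n m : ℕ} {x : Site 2}

/-- `ω` has a vertical walk bond in its rightmost column, at time `j`. [cite: MadrasSlade1993, Corollary 3.2.6 (proof: the bond at the largest point)] -/
def RightBond (n : ℕ) (ω : ℕ → Site 2) (j : ℕ) : Prop := j < n ∧ ω (j + 1) 0 = ω j 0 ∧ ∀ k, k ≤ n → ω k 0 ≤ ω j 0

/-- `ω` has a vertical walk bond in its leftmost column, at time `j`. [cite: MadrasSlade1993, Corollary 3.2.6 (proof)] -/
def LeftBond (n : ℕ) (ω : ℕ → Site 2) (j : ℕ) : Prop := j < n ∧ ω (j + 1) 0 = ω j 0 ∧ ∀ k, k ≤ n → ω j 0 ≤ ω k 0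

/-- `LeftBond` is `RightBond` of the reflected walk. [cite: MadrasSlade1993, §1.1 (lattice symmetry)] -/
theorem rightBond_reflW_iff {ω : ℕ → Site 2} {j : ℕ} : RightBond n (reflW ω) j ↔ LeftBond n ω j := by
  unfold RightBond LeftBond
  simp only [reflW_apply_zero]
  constructor
  · rintro ⟨h1, h2, h3⟩; exact ⟨h1, by omega, fun k hk => by have := h3 k hk; omega⟩
  · rintro ⟨h1, h2, h3⟩; exact ⟨h1, by omega, fun k hk => by have := h3 k hk; omega⟩

open Classical in
/-- The insertable walks of `E_n(x)`: a vertical walk bond in an extreme column. [cite: MadrasSlade1993, Corollary 3.2.6 (proof)] -/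
def ins (n : ℕ) (x : Site 2) : Finset (ℕ → Site 2) :=
  (endAt n x).filter fun ω => ∃ j, RightBond n ω j ∨ LeftBond n ω j

/-- Membership in `ins`. [cite: MadrasSlade1993, Corollary 3.2.6 (proof)] -/
theorem mem_ins {ω : ℕ → Site 2} : ω ∈ ins n x ↔ ω ∈ endAt n x ∧ ∃ j, RightBond n ω j ∨ LeftBond n ω j := by
  classical
  exact Finset.mem_filter

open Classical in
/-- A chosen insertion datum `(j, side)` of an insertable walk (`side = false`: right, `true`: left); junk otherwise.
[cite: MadrasSlade1993, Corollary 3.2.6 (proof)] -/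
def insDatum (n : ℕ) (ω : ℕ → Site 2) : ℕ × Bool :=
  if h : ∃ j, RightBond n ω j then (Classical.choose h, false)
  else if h' : ∃ j, LeftBond n ω j then (Classical.choose h', true) else (0, false)

/-- Specification of the insertion datum. [cite: MadrasSlade1993, Corollary 3.2.6 (proof)] -/
theorem insDatum_spec {ω : ℕ → Site 2} (h : ∃ j, RightBond n ω j ∨ LeftBond n ω j) :
    ((insDatum n ω).2 = false ∧ RightBond n ω (insDatum n ω).1) ∨
    ((insDatum n ω).2 = true ∧ LeftBond n ω (insDatum n ω).1) := by
  classical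
  unfold insDatum
  by_cases h1 : ∃ j, RightBond n ω j
  · rw [dif_pos h1]; exact Or.inl ⟨rfl, Classical.choose_spec h1⟩
  · have h2 : ∃ j, LeftBond n ω j := by
      obtain ⟨j, hj | hj⟩ := h
      · exact absurd ⟨j, hj⟩ h1
      · exact ⟨j, hj⟩
    rw [dif_neg h1, dif_pos h2]; exact Or.inr ⟨rfl, Classical.choose_spec h2⟩

/-- The one-sided join at a given bond, on a given side (right: the brick join of `ω`; left: reflect, join, reflect back).
[cite: MadrasSlade1993, Corollary 3.2.6 (proof: concatenation of `φ` and the polygons of `Q_I[N − L_N]`)] -/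
def sideGlue (m : ℕ) (ω υ : ℕ → Site 2) (j : ℕ) (side : Bool) : ℕ → Site 2 :=
  if side then reflW (glue m (reflW ω) j (detour m (reflW ω) υ j (kOf m υ)))
  else glue m ω j (detour m ω υ j (kOf m υ))

/-- The side join lands in `E_{n+m+3}(x)`. [cite: MadrasSlade1993, Corollary 3.2.6 (proof)] -/
theorem sideGlue_mem {ω υ : ℕ → Site 2} {j : ℕ} {side : Bool} (hω : ω ∈ endAt n x) (hυ : υ ∈ endAt m (Pi.single 0 1))
    (hm : 2 ≤ m) (hside : (side = false ∧ RightBond n ω j) ∨ (side = true ∧ LeftBond n ω j)) :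
    sideGlue m ω υ j side ∈ endAt (n + m + 3) x := by
  obtain ⟨hk, hvk, hmin⟩ := kOf_spec hυ hm
  rcases hside with ⟨rfl, hj, hv, hX⟩ | ⟨rfl, hb⟩
  · simp only [sideGlue, Bool.false_eq_true, if_false]
    exact glue_mem hω hj hv hX (detourOK hω hj hv hυ hk hvk hmin)
  · simp only [sideGlue, if_true]
    obtain ⟨hj, hv, hX⟩ := rightBond_reflW_iff.2 hb
    have hω' := reflW_mem hω
    have h := glue_mem hω' hj hv hX (detourOK hω' hj hv hυ hk hvk hmin)
    have := reflW_mem h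
    rwa [Zd.reflCoord_reflCoord] at this

/-- Decoding the outer walk from a one-sided join with known cut time. [cite: MadrasSlade1993, §3.2 (proof of Theorem 3.2.3: "we can reconstruct `P`")] -/
theorem outer_eq_of_glue_eq {ω ω' D D' : ℕ → Site 2} {j : ℕ} (hω : ω ∈ endAt n x) (hω' : ω' ∈ endAt n x)
    (h : glue m ω j D = glue m ω' j D') : ω = ω' := by
  have h1 : ∀ i, i ≤ n → ω i = ω' i := by
    intro i hi
    rcases le_or_gt i j with hij | hij
    · have := congrFun h i; rwa [glue_of_le hij, glue_of_le hij] at this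
    · have := congrFun h (i + m + 3)
      rwa [glue_of_ge (by omega), glue_of_ge (by omega), show i + m + 3 - (m + 3) = i by omega] at this
  funext i
  rcases le_or_gt i n with hi | hi
  · exact h1 i hi
  · rw [(mem_endAt_iff.1 hω).1.2.1 i hi.le, (mem_endAt_iff.1 hω').1.2.1 i hi.le]; exact h1 n le_rfl

/-- The two-sided encoding: joined walk, cut time, side, polygon cut time, direction bit.
[cite: MadrasSlade1993, Corollary 3.2.6 (proof)] -/
def insCode (n m : ℕ) (p : (ℕ → Site 2) × (ℕ → Site 2)) : (ℕ → Site 2) × (ℕ × Bool) × ℕ × Bool :=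
  (sideGlue m p.1 p.2 (insDatum n p.1).1 (insDatum n p.1).2, insDatum n p.1, kOf m p.2,
    sameDir (if (insDatum n p.1).2 then reflW p.1 else p.1) p.2 (insDatum n p.1).1 (kOf m p.2))

/-- **The two-sided encoding is injective** on `Ins_n(x) × E_m(e₀)`. [cite: MadrasSlade1993, Corollary 3.2.6 (proof); §3.2 (proof of Theorem 3.2.3: reconstruction)] -/
theorem insCode_injOn (hm : 2 ≤ m) : Set.InjOn (insCode n m) ↑(ins n x ×ˢ endAt m (Pi.single 0 1)) := by
  rintro ⟨ω, υ⟩ hp ⟨ω', υ'⟩ hp' h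
  rw [Finset.coe_product, Set.mem_prod, Finset.mem_coe, Finset.mem_coe] at hp hp'
  obtain ⟨hωi, hυ⟩ := hp
  obtain ⟨hωi', hυ'⟩ := hp'
  dsimp only at hωi hυ hωi' hυ'
  have hω := (mem_ins.1 hωi).1
  have hω' := (mem_ins.1 hωi').1
  simp only [insCode, Prod.mk.injEq] at h
  obtain ⟨hW, hd, hk, hb⟩ := h
  obtain ⟨hkm, -, -⟩ := kOf_spec hυ hm
  set j := (insDatum n ω).1 with hjdef
  set side := (insDatum n ω).2 with hsdef
  set k := kOf m υ with hkdef
  have hj' : (insDatum n ω').1 = j := by rw [← hd]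
  have hs' : (insDatum n ω').2 = side := by rw [← hd]
  rw [hj', hs'] at hW hb
  rw [← hk] at hb
  -- split on the side
  cases hside : side
  · rw [hside] at hW hb
    simp only [sideGlue, Bool.false_eq_true, if_false] at hW hb
    rw [← hk] at hW
    have hωω : ω = ω' := outer_eq_of_glue_eq hω hω' hW
    subst hωω
    refine Prod.ext rfl ?_
    have hD : ∀ i, i ≤ m → detour m ω υ j k i = detour m ω υ' j k i := by
      intro i hi
      have := congrFun hW (j + 2 + i)
      rwa [glue_detour hi, glue_detour hi] at this
    exact detour_decode hυ hυ' hkm hb hD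
  · rw [hside] at hW hb
    simp only [sideGlue, if_true] at hW hb
    rw [← hk] at hW
    have hW' : glue m (reflW ω) j (detour m (reflW ω) υ j k) = glue m (reflW ω') j (detour m (reflW ω') υ' j k) := by
      have := congrArg reflW hW
      rwa [reflW_reflW, reflW_reflW] at this
    have hωω : reflW ω = reflW ω' := outer_eq_of_glue_eq (reflW_mem hω) (reflW_mem hω') hW'
    have hωω' : ω = ω' := by
      have := congrArg reflW hωω; rwa [reflW_reflW, reflW_reflW] at this
    subst hωω'
    refine Prod.ext rfl ?_
    have hD : ∀ i, i ≤ m → detour m (reflW ω) υ j k i = detour m (reflW ω) υ' j k i := by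
      intro i hi
      have := congrFun hW' (j + 2 + i)
      rwa [glue_detour hi, glue_detour hi] at this
    exact detour_decode hυ hυ' hkm hb hD

/-- **Two-sided insertion inequality**: `#Ins_n(x) · c_m(0,e₀;ℍ) ≤ 4nm · c_{n+m+3}(0,x;ℍ)` for `m ≥ 2`.
[cite: MadrasSlade1993, Corollary 3.2.6, eq. (3.2.11), p. 68; Lemma 7.3.3 p. 247] -/
theorem card_ins_mul_le (hm : 2 ≤ m) :
    #(ins n x) * endAtCount m (Pi.single 0 1) ≤ 4 * n * m * endAtCount (n + m + 3) x := by
  classical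
  rcases Nat.eq_zero_or_pos n with rfl | hn
  · -- `n = 0`: no insertable walks
    have : ins 0 x = ∅ := by
      rw [Finset.eq_empty_iff_forall_notMem]
      intro ω hω
      obtain ⟨-, j, ⟨hj, -⟩ | ⟨hj, -⟩⟩ := mem_ins.1 hω <;> omega
    simp [this]
  have hmaps : Set.MapsTo (insCode n m) ↑(ins n x ×ˢ endAt m (Pi.single 0 1))
      ↑(endAt (n + m + 3) x ×ˢ ((range n ×ˢ (univ : Finset Bool)) ×ˢ (range m ×ˢ (univ : Finset Bool)))) := by
    rintro ⟨ω, υ⟩ hp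
    rw [Finset.coe_product, Set.mem_prod, Finset.mem_coe, Finset.mem_coe] at hp
    obtain ⟨hωi, hυ⟩ := hp
    obtain ⟨hω, hex⟩ := mem_ins.1 hωi
    have hspec := insDatum_spec (n := n) hex
    simp only [insCode, Finset.coe_product, Set.mem_prod, Finset.mem_coe, Finset.mem_range, Finset.coe_univ,
      Set.mem_univ, and_true]
    refine ⟨sideGlue_mem hω hυ hm hspec, ?_, (kOf_spec hυ hm).1⟩
    rcases hspec with ⟨-, hj, -⟩ | ⟨-, hj, -⟩ <;> exact hj
  have h := Finset.card_le_card_of_injOn (insCode n m) hmaps (insCode_injOn hm)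
  rw [Finset.card_product, Finset.card_product, Finset.card_product, Finset.card_product, Finset.card_product,
    Finset.card_range, Finset.card_range, Finset.card_univ, Fintype.card_bool] at h
  unfold endAtCount
  calc #(ins n x) * #(endAt m (Pi.single 0 1)) ≤ #(endAt (n + m + 3) x) * (n * 2 * (m * 2)) := h
    _ = 4 * n * m * #(endAt (n + m + 3) x) := by ring

end Ins

/-! ### Non-insertable walks are confined to the slab between `0` and `x` -/

section NotIns

variable {n : ℕ} {x : Site 2}

open Classical in
/-- The non-insertable walks of `E_n(x)`. [cite: MadrasSlade1993, Lemma 7.3.3 (proof: walks inside the cube)] -/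
def notIns (n : ℕ) (x : Site 2) : Finset (ℕ → Site 2) :=
  (endAt n x).filter fun ω => ¬ ∃ j, RightBond n ω j ∨ LeftBond n ω j

/-- `E_n(x) = Ins ⊔ notIns`. [cite: MadrasSlade1993, Lemma 7.3.3 (proof)] -/
theorem card_endAt_eq_ins_add (n : ℕ) (x : Site 2) : #(endAt n x) = #(ins n x) + #(notIns n x) := by
  classical
  rw [ins, notIns]; exact (Finset.card_filter_add_card_filter_not _).symm

/-- **Both-bad walks live in the slab**: a non-insertable `ω ∈ E_n(x)` has all its first coordinates between `0` and `x 0`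
(the extreme columns are attained only at the endpoints). [cite: MadrasSlade1993, Lemma 7.3.3 (proof: "at least one point of ω must lie outside the cube" — contrapositive)] -/
theorem confined_of_notIns {ω : ℕ → Site 2} (hω : ω ∈ notIns n x) :
    ∀ k, k ≤ n → min 0 (x 0) ≤ ω k 0 ∧ ω k 0 ≤ max 0 (x 0) := by
  classical
  obtain ⟨hωe, hno⟩ := Finset.mem_filter.1 hω
  obtain ⟨⟨h0, -, -, -⟩, hn⟩ := mem_endAt_iff.1 hωe
  intro k hk
  by_contra hbad
  rw [not_and_or] at hbad
  rcases hbad with hlt | hgt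
  · -- some vertex strictly left of both endpoints: the minimal column has an interior vertex
    obtain ⟨i, hi, hmin⟩ := exists_min_image (range (n + 1)) (fun t => ω t 0) ⟨0, by simp⟩
    simp only [mem_range, Nat.lt_succ_iff] at hi hmin
    have hi0 : 0 < i := by
      rcases Nat.eq_zero_or_pos i with rfl | h
      · have := hmin k hk; rw [h0] at this; simp at this hlt; omega
      · exact h
    have hin : i < n := by
      rcases lt_or_eq_of_le hi with h | rfl
      · exact h
      · have := hmin k hk; rw [hn] at this; simp at hlt; omega
    obtain ⟨j, hj⟩ := exists_vertical_of_interior_min hωe hi0 hin hmin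
    exact hno ⟨j, Or.inr hj⟩
  · obtain ⟨i, hi, hmax⟩ := exists_max_image (range (n + 1)) (fun t => ω t 0) ⟨0, by simp⟩
    simp only [mem_range, Nat.lt_succ_iff] at hi hmax
    have hi0 : 0 < i := by
      rcases Nat.eq_zero_or_pos i with rfl | h
      · have := hmax k hk; rw [h0] at this; simp at this hgt; omega
      · exact h
    have hin : i < n := by
      rcases lt_or_eq_of_le hi with h | rfl
      · exact h
      · have := hmax k hk; rw [hn] at this; simp at hgt; omega
    obtain ⟨j, hj⟩ := exists_vertical_of_interior hωe hi0 hin hmax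
    exact hno ⟨j, Or.inl hj⟩

/-- For `x₀ = 0` there are no non-insertable walks of length `n ≥ 2` (a walk confined to one column has at most one step).
[cite: MadrasSlade1993, Lemma 7.3.3 (proof)] -/
theorem notIns_eq_empty_of_zero (hx : x 0 = 0) (hn : 2 ≤ n) : notIns n x = ∅ := by
  classical
  rw [Finset.eq_empty_iff_forall_notMem]
  intro ω hω
  have hc := confined_of_notIns hω
  obtain ⟨hωe, -⟩ := Finset.mem_filter.1 hω
  obtain ⟨⟨h0, -, hbw, hinj⟩, -⟩ := mem_endAt_iff.1 hωe
  rw [hx] at hc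
  simp only [min_self, max_self] at hc
  have c0 : ω 0 0 = 0 := by rw [h0]; rfl
  have c1 : ω 1 0 = 0 := by have := hc 1 (by omega); omega
  have c2 : ω 2 0 = 0 := by have := hc 2 (by omega); omega
  have hb0 := hbw 0 (by omega)
  have hb1 := hbw 1 (by omega)
  rw [show (0 : ℕ) + 1 = 1 from rfl] at hb0
  rw [show (1 : ℕ) + 1 = 2 from rfl] at hb1
  have a1 := vertical_cases hb0 (by rw [c0, c1])
  have a2 := vertical_cases hb1 (by rw [c1, c2])
  have hne : ω 2 ≠ ω 0 := fun h => by
    have := hinj (show 2 ∈ {k | k ≤ n} by simp; omega) (show 0 ∈ {k | k ≤ n} by simp) h; omega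
  have h01 : ω 0 1 = 0 := by rw [h0]; rfl
  apply hne
  funext l; fin_cases l
  · show ω 2 0 = ω 0 0; omega
  · show ω 2 1 = ω 0 1; omega

/-- **Non-insertable walks are counted by the slab**: for `x₀ ≥ 1`, `#notIns_n(x) ≤ c_n(Slab_{x₀})`; for `x₀ ≤ −1`, by reflection,
`≤ c_n(Slab_{−x₀})`. [cite: MadrasSlade1993, §8.2 (8.2.1) (walks in a slab)] -/
theorem card_notIns_le_slabCount (hx : x 0 ≠ 0) : #(notIns n x) ≤ slabCount (x 0).natAbs n := by
  classical
  -- the map `ω ↦ (0, ω)` or `(0, reflW ω)`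
  set H : ℕ := (x 0).natAbs with hH
  by_cases hpos : 0 < x 0
  · refine Finset.card_le_card_of_injOn (fun ω => ((0 : Site 2), ω)) (fun ω hω => ?_) (fun ω _ ω' _ h => by
      simpa using h)
    rw [Finset.mem_coe] at hω
    have hc := confined_of_notIns hω
    obtain ⟨hωe, -⟩ := Finset.mem_filter.1 hω
    obtain ⟨hsaws, -⟩ := mem_endAt.1 hωe
    rw [Finset.mem_coe, mem_slabPairs]
    refine ⟨zero_mem_slabStarts H, saws_subset n hsaws, fun i hi => by simpa using (mem_saws.1 hsaws).2 i hi, fun k hk => ?_⟩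
    have := hc k hk
    simp only [zero_add, InSlab, hH]
    constructor <;> omega
  · have hneg : x 0 < 0 := by omega
    refine Finset.card_le_card_of_injOn (fun ω => ((0 : Site 2), reflW ω)) (fun ω hω => ?_) (fun ω _ ω' _ h => by
      have := congrArg (fun p : Site 2 × (ℕ → Site 2) => reflW p.2) h
      simpa using this)
    rw [Finset.mem_coe] at hω
    have hc := confined_of_notIns hω
    obtain ⟨hωe, -⟩ := Finset.mem_filter.1 hω
    obtain ⟨hsaws, -⟩ := mem_endAt.1 hωe
    have hsaws' := reflect_mem_saws hsaws
    rw [Finset.mem_coe, mem_slabPairs]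
    refine ⟨zero_mem_slabStarts H, saws_subset n hsaws', fun i hi => by simpa [reflW] using (mem_saws.1 hsaws').2 i hi,
      fun k hk => ?_⟩
    have := hc k hk
    simp only [zero_add, InSlab, hH, reflW_apply_zero]
    constructor <;> omega

end NotIns

end PolygonConcat

end HexBW


namespace HV

/-! ### The slab count is eventually less than half of the fixed-endpoint count -/

section Slab

/-- `2 e^{c√N} θ^N ≤ 1` for all large `N` when `0 < θ < 1`. [folklore] -/
private theorem two_exp_sqrt_mul_pow_le {c θ : ℝ} (hc : 0 ≤ c) (hθ0 : 0 < θ) (hθ1 : θ < 1) :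
    ∃ N₃ : ℕ, ∀ N : ℕ, N₃ ≤ N → 2 * Real.exp (c * Real.sqrt N) * θ ^ N ≤ 1 := by
  set L : ℝ := -Real.log θ with hL
  have hL0 : 0 < L := by rw [hL, neg_pos]; exact Real.log_neg hθ0 hθ1
  refine ⟨⌈(2 * c / L) ^ 2⌉₊ + ⌈2 * Real.log 2 / L⌉₊ + 1, fun N hN => ?_⟩
  have hN1 : (⌈(2 * c / L) ^ 2⌉₊ : ℝ) ≤ N := by exact_mod_cast (show ⌈(2 * c / L) ^ 2⌉₊ ≤ N by omega)
  have hN2 : (⌈2 * Real.log 2 / L⌉₊ : ℝ) ≤ N := by exact_mod_cast (show ⌈2 * Real.log 2 / L⌉₊ ≤ N by omega)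
  have h1 : (2 * c / L) ^ 2 ≤ N := (Nat.le_ceil _).trans hN1
  have h2 : 2 * Real.log 2 / L ≤ N := (Nat.le_ceil _).trans hN2
  have hNn : (0 : ℝ) ≤ N := Nat.cast_nonneg N
  have hs : 2 * c / L ≤ Real.sqrt N := by
    rw [show (2 * c / L) = Real.sqrt ((2 * c / L) ^ 2) by rw [Real.sqrt_sq (by positivity)]]
    exact Real.sqrt_le_sqrt h1
  -- `c √N ≤ (L/2) N` and `log 2 ≤ (L/2) N`
  have hA : c * Real.sqrt N ≤ L / 2 * N := by
    have hc' : c ≤ L / 2 * Real.sqrt N := by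
      have := mul_le_mul_of_nonneg_left hs (show 0 ≤ L / 2 by positivity)
      rw [show L / 2 * (2 * c / L) = c by field_simp] at this
      exact this
    have := mul_le_mul_of_nonneg_right hc' (Real.sqrt_nonneg N)
    rw [mul_assoc, Real.mul_self_sqrt hNn] at this
    exact this
  have hB : Real.log 2 ≤ L / 2 * N := by
    have := mul_le_mul_of_nonneg_left h2 (show 0 ≤ L / 2 by positivity)
    rw [show L / 2 * (2 * Real.log 2 / L) = Real.log 2 by field_simp] at this
    exact this
  have hpow : θ ^ N = Real.exp ((N : ℝ) * Real.log θ) := by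
    rw [← Real.exp_log (pow_pos hθ0 N), Real.log_pow]
  have : 2 * Real.exp (c * Real.sqrt N) * θ ^ N = Real.exp (Real.log 2 + c * Real.sqrt N + N * Real.log θ) := by
    rw [hpow, Real.exp_add, Real.exp_add, Real.exp_log (by norm_num : (0 : ℝ) < 2)]
  rw [this, Real.exp_le_one_iff]
  have : (N : ℝ) * Real.log θ = -(L * N) := by rw [hL]; ring
  rw [this]; linarith

/-- **The armchair slab is negligible against the fixed-endpoint class**: for `x ≠ 0` with `H := |x₀| ≥ 1` and the envelope of
`E_N(x)` along the class `N = 2m + δ`, eventually `2·c_N(Slab_H) ≤ #E_N(x)` (`μ(Slab_H) < μ_ℍ`, a-p5's `slabConnectiveConstant_lt_hex`,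
against `e^{−c√N} μ_ℍ^N ≤ #E_N(x)`). [cite: MadrasSlade1993, §8.2 (strip constants) and Corollary 3.2.6 p. 68] -/
theorem slabCount_eventually_le_half {x : HV} {c : ℝ} {δ H m₀ : ℕ} (hc : 0 ≤ c) (hH : 1 ≤ H)
    (hm₀ : ∀ m : ℕ, m₀ ≤ m →
      Real.exp (-(c * Real.sqrt ((2 * m + δ : ℕ) : ℝ))) * hexConnectiveConstant ^ (2 * m + δ) ≤ #(endFin x (2 * m + δ))) :
    ∃ m₂ : ℕ, ∀ m : ℕ, m₂ ≤ m → 2 * (HexBW.slabCount H (2 * m + δ) : ℝ) ≤ #(endFin x (2 * m + δ)) := by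
  set lam := HexBW.slabConnectiveConstant H with hlam
  have hlt : lam < hexConnectiveConstant := HexBW.slabConnectiveConstant_lt_hex hH
  have hlam0 : 0 < lam := HexBW.slabConnectiveConstant_pos hH
  have hμ0 : 0 < hexConnectiveConstant := hexConnectiveConstant_pos
  set ρ : ℝ := (lam + hexConnectiveConstant) / 2 with hρ
  have hρ1 : lam < ρ := by rw [hρ]; linarith
  have hρ2 : ρ < hexConnectiveConstant := by rw [hρ]; linarith
  have hρ0 : 0 < ρ := by linarith
  -- eventually `slabCount H n < ρ^n`
  have hev : ∀ᶠ n : ℕ in atTop, (HexBW.slabCount H n : ℝ) ^ (1 / (n : ℝ)) < ρ :=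
    (HexBW.tendsto_slabCount_rpow hH).eventually (gt_mem_nhds hρ1)
  obtain ⟨n₂, hn₂⟩ := Filter.eventually_atTop.1 hev
  have hslab : ∀ n : ℕ, n₂ ≤ n → 1 ≤ n → (HexBW.slabCount H n : ℝ) ≤ ρ ^ n := by
    intro n hn hn1
    have h := hn₂ n hn
    have hs0 : (0 : ℝ) ≤ HexBW.slabCount H n := Nat.cast_nonneg _
    have hn0 : (n : ℝ) ≠ 0 := by exact_mod_cast (show n ≠ 0 by omega)
    have : ((HexBW.slabCount H n : ℝ) ^ (1 / (n : ℝ))) ^ (n : ℝ) = HexBW.slabCount H n := by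
      rw [← Real.rpow_mul hs0, one_div_mul_cancel hn0, Real.rpow_one]
    rw [← this, ← Real.rpow_natCast ρ n]
    exact Real.rpow_le_rpow (Real.rpow_nonneg hs0 _) h.le (Nat.cast_nonneg n)
  -- `2 ρ^N ≤ e^{-c√N} μ^N` eventually
  set θ : ℝ := ρ / hexConnectiveConstant with hθ
  have hθ0 : 0 < θ := by positivity
  have hθ1 : θ < 1 := by rw [hθ, div_lt_one hμ0]; exact hρ2
  obtain ⟨N₃, hN₃⟩ := two_exp_sqrt_mul_pow_le hc hθ0 hθ1
  refine ⟨max (max m₀ n₂) (N₃ + 1), fun m hm => ?_⟩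
  set N : ℕ := 2 * m + δ with hN
  have hm0 : m₀ ≤ m := le_trans (le_trans (le_max_left _ _) (le_max_left _ _)) hm
  have hNn₂ : n₂ ≤ N := by have := le_trans (le_trans (le_max_right _ _) (le_max_left _ _)) hm; omega
  have hN₃' : N₃ ≤ N := by have := le_trans (le_max_right _ _) hm; omega
  have hN1 : 1 ≤ N := by have := le_trans (le_max_right _ _) hm; omega
  have h1 := hslab N hNn₂ hN1
  have h2 := hN₃ N hN₃'
  have h3 := hm₀ m hm0
  rw [← hN] at h3
  -- `2 slab ≤ 2 ρ^N = 2 θ^N μ^N ≤ e^{-c√N} μ^N ≤ #E`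
  have hμN : (0 : ℝ) < hexConnectiveConstant ^ N := pow_pos hμ0 N
  have hρN : ρ ^ N = θ ^ N * hexConnectiveConstant ^ N := by
    rw [← mul_pow]
    congr 1
    rw [hθ]; field_simp
  have hexp : Real.exp (c * Real.sqrt N) * Real.exp (-(c * Real.sqrt N)) = 1 := by
    rw [← Real.exp_add, add_neg_cancel, Real.exp_zero]
  have hE0 : (0 : ℝ) ≤ Real.exp (-(c * Real.sqrt (N : ℝ))) := (Real.exp_pos _).le
  calc 2 * (HexBW.slabCount H N : ℝ) ≤ 2 * ρ ^ N := by linarith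
    _ = (2 * Real.exp (c * Real.sqrt N) * θ ^ N) * (Real.exp (-(c * Real.sqrt N)) * hexConnectiveConstant ^ N) := by
        rw [hρN]
        have := hexp
        calc 2 * (θ ^ N * hexConnectiveConstant ^ N)
            = 2 * θ ^ N * hexConnectiveConstant ^ N * (Real.exp (c * Real.sqrt N) * Real.exp (-(c * Real.sqrt N))) := by
              rw [hexp]; ring
          _ = _ := by ring
    _ ≤ 1 * (Real.exp (-(c * Real.sqrt N)) * hexConnectiveConstant ^ N) :=
        mul_le_mul_of_nonneg_right h2 (by positivity)
    _ ≤ #(endFin x N) := by rw [one_mul]; exact h3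

end Slab

/-! ### The insertion inequality for a general endpoint and the lower rate -/

section Rate

/-- `8 n r ≤ (2(n + 2M) + 3)^6` when `0 ≤ n`, `r ≤ 2M+1`, `0 ≤ M`. [folklore] -/
private theorem eight_mul_mul_le_pow_six {n r M : ℝ} (hn : 0 ≤ n) (hr : 0 ≤ r) (hM : 0 ≤ M) (hrM : r ≤ 2 * M + 1) :
    8 * n * r ≤ (2 * (n + 2 * M) + 3) ^ 6 := by
  set L : ℝ := 2 * (n + 2 * M) + 3 with hL
  have hL3 : 3 ≤ L := by rw [hL]; linarith
  have h1 : 2 * n ≤ L := by rw [hL]; linarith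
  have h2 : 2 * r ≤ L := by rw [hL]; linarith
  have h3 : 8 * n * r ≤ 2 * (L * L) := by
    have := mul_le_mul h1 h2 (by linarith) (by linarith)
    linarith
  have h4 : 2 * (L * L) ≤ L ^ 6 := by
    have hL2 : 9 ≤ L ^ 2 := by nlinarith
    have hL4 : 0 ≤ L ^ 4 := by positivity
    calc 2 * (L * L) = 2 * L ^ 2 := by ring
      _ ≤ L ^ 4 * L ^ 2 := by nlinarith
      _ = L ^ 6 := by ring
  linarith

/-- **Kesten's LOWER ratio rate for every endpoint on `ℍ`, NO hypotheses**: for every `x ≠ 0`, along the bipartite class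
`N = 2m + δ` of `x`, `(2+√2) − c_{N+2}(0,x;ℍ)/c_N(0,x;ℍ) ≤ K·m^{−1/3}` for all large `m`.
[cite: MadrasSlade1993, §7.5 eq. (7.5.2) p. 255; Theorem 7.3.4 (b) p. 248; Lemma 7.3.3 p. 247] [cite: Kesten1963SAW, §4]
[cite: DuminilCopinSmirnov2012, Theorem 1] -/
theorem hexEndpointRatioTwo_lowerRate {x : HV} (hx : x ≠ hvOrigin) :
    ∃ K : ℝ, ∃ m₁ : ℕ, ∀ m : ℕ, m₁ ≤ m →
      (2 + Real.sqrt 2) - (#(endFin x (2 * m + (if x.2.2 then 1 else 0) + 2)) : ℝ) /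
        #(endFin x (2 * m + (if x.2.2 then 1 else 0))) ≤ K * (m : ℝ) ^ (-(1 : ℝ) / 3) := by
  -- the class and the envelope of `x`
  obtain ⟨cx, hcx, hLox⟩ := hexEndpointLo_of_ne hx
  obtain ⟨m₁, hmono⟩ := endFin_eventually_mono_iter_of_ne hx
  generalize hδ : (if x.2.2 then 1 else 0 : ℕ) = δ at hLox hmono ⊢
  have hδ1 : δ ≤ 1 := by rw [← hδ]; split_ifs <;> omega
  obtain ⟨mx, hmx⟩ := id hLox
  -- the polygon envelope (for the auxiliary sequence)
  have hnb2 : hvGraph.Adj hvOrigin nb2 := (adj_hvOrigin_iff nb2).2 (Or.inr (Or.inr rfl))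
  set c₀ : ℝ := Real.log 27060804 + 2 * (6 : ℕ) + 30 + 2 with hc₀def
  have hc₀ : (0 : ℝ) ≤ c₀ := by
    have := Real.log_nonneg (show (1 : ℝ) ≤ 27060804 by norm_num); positivity
  obtain ⟨m₀, hm₀⟩ := hexEndpointLo_of_adjEndLo hexAdjEndLo hnb2
  -- the spliced sequence of `x`
  set N₀ := 2 * mx + δ with hN₀
  set a : ℕ → ℝ := spliceE x δ N₀ with ha
  have hapos : ∀ n, 0 < a n := spliceE_pos hcx hδ1 hmx
  obtain ⟨B, hB1, hK⟩ := spliceE_additive_all hδ1 hcx hLox hmx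
  have hμ1 : (1 : ℝ) ≤ hexConnectiveConstant := one_le_hexConnectiveConstant
  have hμ0 : (0 : ℝ) < hexConnectiveConstant := hexConnectiveConstant_pos
  set B' : ℝ := max B (hexConnectiveConstant ^ 2) with hB'
  have hB1' : 1 ≤ B' := le_trans hB1 (le_max_left _ _)
  have hBμ' : hexConnectiveConstant ^ 2 ≤ B' := le_max_right _ _
  have hK' : ∀ n : ℕ, 1 ≤ n → a (n + 2) / a n - B' / n ≤ a (n + 4) / a (n + 2) := by
    intro n hn
    have h1 := hK n hn
    have hn0 : (0 : ℝ) < n := by exact_mod_cast hn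
    have : B / n ≤ B' / n := div_le_div_of_nonneg_right (le_max_left _ _) hn0.le
    linarith
  -- the auxiliary sequence `e` (rooted polygons) and its envelope, as for polygons
  set e : ℕ → ℝ := fun M => if M ≤ 2 then 1 else max 1 (#(endFin nb2 (2 * (M - 2) + 1)) : ℝ) with he
  have he1 : ∀ M, 1 ≤ e M := by
    intro M; simp only [he]; split_ifs
    · exact le_rfl
    · exact le_max_left _ _
  set A : ℝ := hexConnectiveConstant ^ (2 * m₀ + 7) with hA
  have hA1 : 1 ≤ A := one_le_pow₀ hμ1
  have hlo : ∀ M : ℕ, 2 ≤ M → Real.exp (-(2 * c₀ * Real.sqrt M)) * hexConnectiveConstant ^ (2 * M) ≤ A * e M := by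
    intro M hM
    by_cases hbig : m₀ + 3 ≤ M
    · have h1 := hm₀ (M - 2) (by omega)
      have hM3 : ¬ M ≤ 2 := by omega
      have hE : (#(endFin nb2 (2 * (M - 2) + 1)) : ℝ) ≤ e M := by
        simp only [he, if_neg hM3]; exact le_max_right _ _
      have hpow : hexConnectiveConstant ^ (2 * M) = hexConnectiveConstant ^ 3 * hexConnectiveConstant ^ (2 * (M - 2) + 1) := by
        rw [← pow_add]; congr 1; omega
      have h3 : hexConnectiveConstant ^ 3 ≤ A := pow_le_pow_right₀ hμ1 (by omega)
      have hsq : Real.exp (-(2 * c₀ * Real.sqrt M)) ≤ Real.exp (-(c₀ * Real.sqrt ((2 * (M - 2) + 1 : ℕ) : ℝ))) := by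
        rw [Real.exp_le_exp, neg_le_neg_iff]
        have hMr : (2 : ℝ) ≤ M := by exact_mod_cast hM
        have hcast : ((2 * (M - 2) + 1 : ℕ) : ℝ) ≤ 4 * (M : ℝ) := by
          have h : (2 * (M - 2) + 1 : ℕ) ≤ 4 * M := by omega
          exact_mod_cast h
        have hs : Real.sqrt ((2 * (M - 2) + 1 : ℕ) : ℝ) ≤ 2 * Real.sqrt (M : ℝ) := by
          rw [show (2 : ℝ) * Real.sqrt (M : ℝ) = Real.sqrt (4 * (M : ℝ)) by
            rw [show (4 : ℝ) * M = 2 ^ 2 * M by ring, Real.sqrt_mul (by norm_num), Real.sqrt_sq (by norm_num)]]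
          exact Real.sqrt_le_sqrt hcast
        nlinarith
      calc Real.exp (-(2 * c₀ * Real.sqrt M)) * hexConnectiveConstant ^ (2 * M)
          ≤ Real.exp (-(c₀ * Real.sqrt ((2 * (M - 2) + 1 : ℕ) : ℝ))) * hexConnectiveConstant ^ (2 * M) :=
            mul_le_mul_of_nonneg_right hsq (by positivity)
        _ = hexConnectiveConstant ^ 3 *
              (Real.exp (-(c₀ * Real.sqrt ((2 * (M - 2) + 1 : ℕ) : ℝ))) * hexConnectiveConstant ^ (2 * (M - 2) + 1)) := by
            rw [hpow]; ring
        _ ≤ A * e M := mul_le_mul h3 (h1.trans hE) (by positivity) (by positivity)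
    · have h1 : Real.exp (-(2 * c₀ * Real.sqrt M)) ≤ 1 := by
        rw [Real.exp_le_one_iff]; have := Real.sqrt_nonneg (M : ℝ); nlinarith
      have h2 : hexConnectiveConstant ^ (2 * M) ≤ A := pow_le_pow_right₀ hμ1 (by omega)
      calc Real.exp (-(2 * c₀ * Real.sqrt M)) * hexConnectiveConstant ^ (2 * M)
          ≤ 1 * A := mul_le_mul h1 h2 (by positivity) zero_le_one
        _ ≤ A * e M := by rw [one_mul]; exact le_mul_of_one_le_right (by positivity) (he1 M)
  -- the brick-wall endpoint and the slab bound
  set z : Site 2 := hvToBW x with hz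
  have hz0 : z ≠ 0 := hvToBW_ne_zero hx
  -- the threshold from the slab (only needed when `z 0 ≠ 0`)
  have hslab : ∃ m₂ : ℕ, ∀ m : ℕ, m₂ ≤ m → z 0 ≠ 0 →
      2 * (HexBW.slabCount (z 0).natAbs (2 * m + δ) : ℝ) ≤ #(endFin x (2 * m + δ)) := by
    by_cases h0 : z 0 = 0
    · exact ⟨0, fun _ _ h => absurd h0 h⟩
    · obtain ⟨m₂, hm₂⟩ := slabCount_eventually_le_half (H := (z 0).natAbs) hcx (by omega) hmx
      exact ⟨m₂, fun m hm _ => hm₂ m hm⟩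
  obtain ⟨m₂, hm₂⟩ := hslab
  -- `#E_N(x) ≤ 2 · #Ins_N(z)` for large `N` of the class
  have hins : ∀ m : ℕ, m₂ ≤ m → 2 ≤ 2 * m + δ →
      (#(endFin x (2 * m + δ)) : ℝ) ≤ 2 * #(HexBW.PolygonConcat.ins (2 * m + δ) z) := by
    intro m hm hN2
    have hsplit := HexBW.PolygonConcat.card_endAt_eq_ins_add (2 * m + δ) z
    have hE : #(endFin x (2 * m + δ)) = #(HexBW.endAt (2 * m + δ) z) := by
      rw [card_endFin_eq_endAtCount]; rfl
    by_cases h0 : z 0 = 0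
    · have := HexBW.PolygonConcat.notIns_eq_empty_of_zero (n := 2 * m + δ) (x := z) h0 hN2
      rw [this, Finset.card_empty, add_zero] at hsplit
      rw [hE, hsplit]
      have : (0 : ℝ) ≤ #(HexBW.PolygonConcat.ins (2 * m + δ) z) := Nat.cast_nonneg _
      linarith
    · have hb := HexBW.PolygonConcat.card_notIns_le_slabCount (n := 2 * m + δ) (x := z) h0
      have h2 := hm₂ m hm h0
      have hbR : (#(HexBW.PolygonConcat.notIns (2 * m + δ) z) : ℝ) ≤ HexBW.slabCount (z 0).natAbs (2 * m + δ) := by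
        exact_mod_cast hb
      have hsplitR : (#(endFin x (2 * m + δ)) : ℝ) =
          #(HexBW.PolygonConcat.ins (2 * m + δ) z) + #(HexBW.PolygonConcat.notIns (2 * m + δ) z) := by
        rw [hE, hsplit]; push_cast; rfl
      linarith
  -- the insertion inequality
  set n₁ : ℕ := 2 * (mx + m₁ + m₂ + 1) + δ with hn₁
  have hSM : ∀ N' M : ℕ, n₁ ≤ N' → N' % 2 = δ → 2 ≤ M →
      a N' * e M ≤ (2 * ((N' : ℝ) + 2 * M) + 3) ^ 6 * a (N' + 2 * M) := by
    intro N' M hN' hpar hM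
    obtain ⟨m, rfl⟩ : ∃ m, N' = 2 * m + δ := ⟨(N' - δ) / 2, by omega⟩
    have hm0 : mx ≤ m := by omega
    have hm1 : m₁ ≤ m := by omega
    have hm2 : m₂ ≤ m := by omega
    have eN : a (2 * m + δ) = #(endFin x (2 * m + δ)) := spliceE_of_class ⟨by omega, by omega⟩
    have eNM : a (2 * m + δ + 2 * M) = #(endFin x (2 * m + δ + 2 * M)) := spliceE_of_class ⟨by omega, by omega⟩
    have hxr : (0 : ℝ) ≤ ((2 * m + δ : ℕ) : ℝ) := Nat.cast_nonneg _
    have hMr : (0 : ℝ) ≤ (M : ℝ) := Nat.cast_nonneg _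
    have hP1 : (1 : ℝ) ≤ (2 * (((2 * m + δ : ℕ) : ℝ) + 2 * M) + 3) ^ 6 := one_le_pow₀ (by linarith)
    have hmonoR : (#(endFin x (2 * m + δ)) : ℝ) ≤ #(endFin x (2 * m + δ + 2 * M)) := by
      exact_mod_cast hmono m hm1 M
    by_cases hcase : ¬ M ≤ 2 ∧ (1 : ℝ) ≤ #(endFin nb2 (2 * (M - 2) + 1))
    · -- two-sided brick join on the insertable walks
      obtain ⟨hM3, hE1⟩ := hcase
      have heM : e M = #(endFin nb2 (2 * (M - 2) + 1)) := by
        simp only [he, if_neg hM3]; exact max_eq_right hE1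
      have hG := HexBW.PolygonConcat.card_ins_mul_le (n := 2 * m + δ) (x := z) (m := 2 * (M - 2) + 1) (by omega)
      rw [show 2 * m + δ + (2 * (M - 2) + 1) + 3 = 2 * m + δ + 2 * M by omega] at hG
      have hGR : (#(HexBW.PolygonConcat.ins (2 * m + δ) z) : ℝ) * #(endFin nb2 (2 * (M - 2) + 1)) ≤
          (4 * ((2 * m + δ : ℕ) : ℝ) * ((2 * (M - 2) + 1 : ℕ) : ℝ)) * #(endFin x (2 * m + δ + 2 * M)) := by
        rw [card_endFin_nb2_eq_endAtCount, card_endFin_eq_endAtCount]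
        exact_mod_cast hG
      have hI := hins m hm2 (by omega)
      have hfac : 8 * ((2 * m + δ : ℕ) : ℝ) * ((2 * (M - 2) + 1 : ℕ) : ℝ) ≤
          (2 * (((2 * m + δ : ℕ) : ℝ) + 2 * M) + 3) ^ 6 := by
        have hr : ((2 * (M - 2) + 1 : ℕ) : ℝ) ≤ 2 * (M : ℝ) + 1 := by
          have h : (2 * (M - 2) + 1 : ℕ) ≤ 2 * M + 1 := by omega
          exact_mod_cast h
        exact eight_mul_mul_le_pow_six hxr (Nat.cast_nonneg _) hMr hr
      rw [eN, eNM, heM]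
      have hE0 : (0 : ℝ) ≤ #(endFin nb2 (2 * (M - 2) + 1)) := Nat.cast_nonneg _
      have hF0 : (0 : ℝ) ≤ #(endFin x (2 * m + δ + 2 * M)) := Nat.cast_nonneg _
      have hr0 : (0 : ℝ) ≤ ((2 * (M - 2) + 1 : ℕ) : ℝ) := Nat.cast_nonneg _
      calc (#(endFin x (2 * m + δ)) : ℝ) * #(endFin nb2 (2 * (M - 2) + 1))
          ≤ (2 * #(HexBW.PolygonConcat.ins (2 * m + δ) z)) * #(endFin nb2 (2 * (M - 2) + 1)) :=
            mul_le_mul_of_nonneg_right hI hE0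
        _ = 2 * ((#(HexBW.PolygonConcat.ins (2 * m + δ) z) : ℝ) * #(endFin nb2 (2 * (M - 2) + 1))) := by ring
        _ ≤ 2 * ((4 * ((2 * m + δ : ℕ) : ℝ) * ((2 * (M - 2) + 1 : ℕ) : ℝ)) * #(endFin x (2 * m + δ + 2 * M))) :=
            mul_le_mul_of_nonneg_left hGR (by norm_num)
        _ = (8 * ((2 * m + δ : ℕ) : ℝ) * ((2 * (M - 2) + 1 : ℕ) : ℝ)) * #(endFin x (2 * m + δ + 2 * M)) := by ring
        _ ≤ (2 * (((2 * m + δ : ℕ) : ℝ) + 2 * M) + 3) ^ 6 * #(endFin x (2 * m + δ + 2 * M)) :=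
            mul_le_mul_of_nonneg_right hfac hF0
    · -- `e M = 1`: eventual monotonicity
      have heM : e M = 1 := by
        simp only [he]
        split_ifs with h
        · rfl
        · rw [not_and_or, not_not, not_le] at hcase
          rcases hcase with h' | h'
          · exact absurd h' h
          · exact max_eq_left h'.le
      rw [heM, mul_one, eN, eNM]
      have hF0 : (0 : ℝ) ≤ #(endFin x (2 * m + δ + 2 * M)) := Nat.cast_nonneg _
      calc (#(endFin x (2 * m + δ)) : ℝ) ≤ #(endFin x (2 * m + δ + 2 * M)) := hmonoR
        _ ≤ (2 * (((2 * m + δ : ℕ) : ℝ) + 2 * M) + 3) ^ 6 * #(endFin x (2 * m + δ + 2 * M)) :=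
          le_mul_of_one_le_left hF0 hP1
  -- the engine
  have hc2 : (0 : ℝ) ≤ 2 * c₀ := by positivity
  obtain ⟨K, hKrate⟩ := Zd.KestenRateLower.lower_rate_cubeRoot_ins (a := a) (e := e) (μ := hexConnectiveConstant)
    (B := B') (c := 2 * c₀) (A := A) (n₁ := n₁) (r := δ) hapos hμ1 hB1' hBμ' hc2 hA1 hK' hlo hSM
  refine ⟨max K 0, n₁ + 1, fun m hm => ?_⟩
  set N := 2 * m + δ with hN
  have hN1 : 2 * n₁ + 1 ≤ N := by omega
  have hm1 : 1 ≤ m := by omega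
  have eN : a N = #(endFin x N) := spliceE_of_class ⟨by omega, by omega⟩
  have eN2 : a (N + 2) = #(endFin x (N + 2)) := spliceE_of_class ⟨by omega, by omega⟩
  have hsq : hexConnectiveConstant ^ 2 = 2 + Real.sqrt 2 := hexConnectiveConstant_sq
  have hmr : (0 : ℝ) < m := by exact_mod_cast (show 0 < m by omega)
  have hrpow0 : (0 : ℝ) ≤ (m : ℝ) ^ (-(1 : ℝ) / 3) := Real.rpow_nonneg hmr.le _
  set u : ℝ := (2 + Real.sqrt 2) - (#(endFin x (N + 2)) : ℝ) / #(endFin x N) with hu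
  show u ≤ max K 0 * (m : ℝ) ^ (-(1 : ℝ) / 3)
  rcases le_or_gt u 0 with hu0 | hu0
  · exact hu0.trans (mul_nonneg (le_max_right _ _) hrpow0)
  have hdev : a (N + 2) / a N ≤ hexConnectiveConstant ^ 2 - u := by
    rw [eN, eN2, hsq, hu]; linarith
  have h1 := hKrate N hN1 (by omega) u hu0 hdev
  have hmN : (m : ℝ) ≤ N := by exact_mod_cast (show m ≤ N by omega)
  have hNr : (0 : ℝ) < N := by linarith
  have hanti : (N : ℝ) ^ (-(1 : ℝ) / 3) ≤ (m : ℝ) ^ (-(1 : ℝ) / 3) := by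
    rw [show (-(1 : ℝ) / 3) = -((1 : ℝ) / 3) by ring, Real.rpow_neg hNr.le, Real.rpow_neg hmr.le]
    exact inv_anti₀ (Real.rpow_pos_of_pos hmr _) (Real.rpow_le_rpow hmr.le hmN (by norm_num))
  calc u ≤ K * (N : ℝ) ^ (-(1 : ℝ) / 3) := h1
    _ ≤ max K 0 * (N : ℝ) ^ (-(1 : ℝ) / 3) := mul_le_mul_of_nonneg_right (le_max_left _ _) (Real.rpow_nonneg hNr.le _)
    _ ≤ max K 0 * (m : ℝ) ^ (-(1 : ℝ) / 3) := mul_le_mul_of_nonneg_left hanti (le_max_right _ _)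

/-- **Kesten's (7.5.2) on the honeycomb lattice for EVERY endpoint, both sides, NO hypotheses**: for every `x ≠ 0`, along the
bipartite class `N = 2m + δ` of `x` and all large `m`, `−K m^{−1/3} ≤ c_{N+2}(0,x;ℍ)/c_N(0,x;ℍ) − (2+√2) ≤ K m^{−1/4}`
(the `ℍ` twin of `Zd.Kesten1963_ratioRate_endpoint_allDim`).
[cite: MadrasSlade1993, §7.5 eq. (7.5.2) p. 255; Theorem 7.3.4 (b) p. 248] [cite: Kesten1963SAW, §4] [cite: DuminilCopinSmirnov2012, Theorem 1] -/
theorem hexEndpointRatioTwo_rate {x : HV} (hx : x ≠ hvOrigin) :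
    ∃ K : ℝ, ∃ m₁ : ℕ, ∀ m : ℕ, m₁ ≤ m →
      -K * (m : ℝ) ^ (-(1 : ℝ) / 3) ≤ (#(endFin x (2 * m + (if x.2.2 then 1 else 0) + 2)) : ℝ) /
          #(endFin x (2 * m + (if x.2.2 then 1 else 0))) - (2 + Real.sqrt 2) ∧
      (#(endFin x (2 * m + (if x.2.2 then 1 else 0) + 2)) : ℝ) / #(endFin x (2 * m + (if x.2.2 then 1 else 0))) -
          (2 + Real.sqrt 2) ≤ K * (m : ℝ) ^ (-(1 : ℝ) / 4) := by
  obtain ⟨K₁, m₁, h₁⟩ := hexEndpointRatioTwo_lowerRate hx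
  obtain ⟨K₂, m₂, h₂⟩ := hexEndpointRatioTwo_upperRate hx
  refine ⟨max K₁ K₂, max m₁ m₂, fun m hm => ⟨?_, ?_⟩⟩
  · have h := h₁ m (le_trans (le_max_left _ _) hm)
    have h0 : (0 : ℝ) ≤ (m : ℝ) ^ (-(1 : ℝ) / 3) := Real.rpow_nonneg (Nat.cast_nonneg m) _
    have : K₁ * (m : ℝ) ^ (-(1 : ℝ) / 3) ≤ max K₁ K₂ * (m : ℝ) ^ (-(1 : ℝ) / 3) :=
      mul_le_mul_of_nonneg_right (le_max_left _ _) h0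
    linarith
  · have h := h₂ m (le_trans (le_max_right _ _) hm)
    have h0 : (0 : ℝ) ≤ (m : ℝ) ^ (-(1 : ℝ) / 4) := Real.rpow_nonneg (Nat.cast_nonneg m) _
    exact h.trans (mul_le_mul_of_nonneg_right (le_max_right _ _) h0)

end Rate

end HV

end Literature.Probability.RandomPlanarGeometry.SAW

end
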